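/-
Copyright: the b2b-balaban T⁴-continuum CRUX team, row NE7b OWNER lineage `t4-ne7b-p1` (gen 141). Project licence.
-/
import Summits.QuantumFields.BalabanUV.T4Continuum.Spine.NE7b.SupTruncationSingleCut

/-!
# THE CUT BOUNDS OF THE FOURTH CUMULANT WITH THE WEIGHTS (SCOPING (d13)(2), sixth file).  In the Gibbs format of (447) (`ν ∝ e^{−V}dz` on
# `ℝ^ι`, one-site floors `c`, Dobrushin matrix `J∕c` with rows `≤ γ < 1`, an admissible `D`), four class observables `F₁, …, F₄` (vectors
# `a₁, …, a₄`) whose Dobrushin bilinear forms DECAY, `B(a_i,a_j) = Σ_w(Dᵀa_i)_w(Dᵀa_j)_w∕c_w ≤ K∕r_{ij}²⁴` for pair weights `r_{ij} ≥ 1`, and whose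
# centred second∕fourth∕sixth moments are `≤ M₂, M₄, M₆` (the sixth a LETTER here), satisfy — choosing the truncation level `R = r_min⁶`,
# `r_min` the least weight crossing the cut, in (489)∕(490):
#   pair cut   `|E[f₁f₂f₃f₄] − E[f₁f₂]E[f₃f₄]| ≤ (4K + 2M₄ + 2M₆ + 2M₂(M₂+M₄))∕min(r₁₃,r₁₄,r₂₃,r₂₄)⁶`,
#   single cut `|E[f₁f₂f₃f₄]| ≤ (3K + 4M₄ + 4M₆)∕min(r₁₂,r₁₃,r₁₄)⁶`,
#   pairing    `|E[f_if_j]| ≤ K∕r_{ij}²⁴`   (`f_i = F_i − E_νF_i`)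
# — integer powers throughout (`R²·K∕r²⁴ = K∕r¹²`, no cube roots); by relabelling, these two generic bounds give all SEVEN cuts of (487)
# (next file) (row NE7b, node U5c; (447) `abs_cov_le_kernel_gibbs`, (489) `group_cov_two_two_le`, (490) `group_cov_one_three_le`, (445)∕(446) BY NAME;
# [folklore])

Cell `pub-balaban`, sub-cell `t4`, spine estimate NE7b (`T4WeightBudget.RelWeightBound`; the cell's OWN estimate — NOT PRINTED in
[Bałaban 1983–89], NOT PROVED).  Crux-route work under `Spine/NE7b/` by the row OWNER (`t4-ne7b-p1` gen 141, file (491)) under FREEZE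
(0)'s crux-prover clause; NOTHING of Bałaban's is named as a Lean object, valued or asserted; no `T4Continuum/Support` leaf typed; no
`def`, no notation; zero `sorry`.  Imports (BY NAME): the OWNER's (490) `…SupTruncationSingleCut` (`group_cov_one_three_le`; through it (489)
`group_cov_two_two_le`, (447), (445) `SupCoordinateLipschitzClass.*`, (446) `memLp_coord_tilted`).

WHAT IS PROVED ([folklore]):
* §1 `centred_pair_eq_cov`, **`pairing_abs_le`** (`|E[f_if_j]| ≤ K∕r²⁴`); `pow_bookkeeping` (`K∕r²⁴ ≤ K∕r_min²⁴ ≤ K∕r_min⁶`, `(r_min⁶)²·(4K∕r_min²⁴) ≤ 4K∕r_min⁶`).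
* §2 **`pair_cut_bound`** (the `2|2` display), **`single_cut_bound`** (the `1|3` display); §3 toy.

HONEST (what this is NOT).  Two generic cut bounds; the seven instantiations with the crossing pairings, (487)'s tree bound and (488)'s row sums
are the next file; the sixth moment `M₆` is a LETTER (its Poincaré discharge needs (423)'s Gaussian moments up to `|φ|¹²` — NOT typed); the
cumulant form of `∂⁴W` NOT typed; scalar skeleton ((A3), NC-NE7b-α UNRULED); nothing of Bałaban's asserted.  BY-NAME EFFECT ON THE WALL: NONE.
NE7b NOT PRINTED ∕ NOT PROVED; spine PROVED 0∕9; rung (B)+1 — the programme's measures remain FINITE-torus statements; NOT the mass gap, NOT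
Clay.  HONEST DEPENDENCY: continuum YM on T⁴ ⇐ BetaPertH ∧ nine spine estimates (0∕9 proved); BetaPertH ⇐ (D1) ∧ (D4) ∧ CAP+tail; G-an2-4
gates asym, D1 and NE2∕3∕4.
-/

set_option autoImplicit false

noncomputable section

namespace Summit.QuantumFields.BalabanUV.T4Continuum.NE7b.SupFourthCumulantCutBounds

open MeasureTheory Real Set Function Finset
open scoped BigOperators
open SupDobrushinCovarianceGibbs (abs_cov_le_kernel_gibbs)
open SupOneSiteResamplingInvariance (memLp_coord_tilted)
open SupDobrushinGroupCovariance (group_cov_two_two_le)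
open SupTruncationSingleCut (group_cov_one_three_le)

variable {ι : Type} [Fintype ι] [DecidableEq ι]

variable {V : (ι → ℝ) → ℝ} {V₁ : ι → (ι → ℝ) → ℝ} {c : ι → ℝ} {Cw γ : ℝ} {J D : ι → ι → ℝ}
  {P : ι → ((ι → ℝ) → ℝ) → ((ι → ℝ) → ℝ)} {F₁ F₂ F₃ F₄ : (ι → ℝ) → ℝ} {a₁ a₂ a₃ a₄ : ι → ℝ}

/-! ## §1. Pairings and power bookkeeping -/

/-- **The centred pair is the covariance**: `∫(F−EF)(G−EG)dν = ∫FG dν − (∫F)(∫G)` for class observables (all integrable). [folklore] -/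
theorem centred_pair_eq_cov (hV0 : Integrable (fun ω : ι → ℝ => exp (-V ω))) (hV2 : ∀ z, Integrable (fun ω : ι → ℝ => ω z ^ 2 * exp (-V ω)))
    (h1 : ∀ z ω s t, |F₁ (update ω z s) - F₁ (update ω z t)| ≤ a₁ z * |s - t|)
    (h2 : ∀ z ω s t, |F₂ (update ω z s) - F₂ (update ω z t)| ≤ a₂ z * |s - t|) :
    ∫ ω, (F₁ ω - (∫ ω', F₁ ω' ∂((volume : Measure (ι → ℝ)).tilted fun ω => -V ω))) * (F₂ ω - (∫ ω', F₂ ω' ∂((volume : Measure (ι → ℝ)).tilted fun ω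
        => -V ω))) ∂((volume : Measure (ι → ℝ)).tilted fun ω => -V ω) =
      (∫ ω, F₁ ω * F₂ ω ∂((volume : Measure (ι → ℝ)).tilted fun ω => -V ω)) - (∫ ω', F₁ ω' ∂((volume : Measure (ι → ℝ)).tilted fun ω => -V ω)) * (∫
          ω', F₂ ω' ∂((volume : Measure (ι → ℝ)).tilted fun ω => -V ω)) := by
  set ν : Measure (ι → ℝ) := (volume : Measure (ι → ℝ)).tilted fun ω => -V ω with hν
  haveI : IsProbabilityMeasure ν := isProbabilityMeasure_tilted hV0
  have hμ2 : ∀ z, MemLp (fun ω : ι → ℝ => ω z) 2 ν := memLp_coord_tilted hV0 hV2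
  have i1 : Integrable F₁ ν := SupCoordinateLipschitzClass.integrable h1 hμ2
  have i2 : Integrable F₂ ν := SupCoordinateLipschitzClass.integrable h2 hμ2
  have i12 : Integrable (fun ω => F₁ ω * F₂ ω) ν := SupCoordinateLipschitzClass.integrable_mul h1 h2 hμ2
  set m1 : ℝ := ∫ ω', F₁ ω' ∂ν
  set m2 : ℝ := ∫ ω', F₂ ω' ∂ν
  have e : ∀ ω, (F₁ ω - m1) * (F₂ ω - m2) = F₁ ω * F₂ ω - m2 * F₁ ω - m1 * F₂ ω + m1 * m2 := fun ω => by ring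
  simp_rw [e]
  have s1 : Integrable (fun ω => F₁ ω * F₂ ω - m2 * F₁ ω) ν := i12.sub (i1.const_mul m2)
  have s2 : Integrable (fun ω => F₁ ω * F₂ ω - m2 * F₁ ω - m1 * F₂ ω) ν := s1.sub (i2.const_mul m1)
  rw [integral_add s2 (integrable_const _), integral_sub s1 (i2.const_mul m1), integral_sub i12 (i1.const_mul m2), integral_const_mul,
    integral_const_mul, integral_const, probReal_univ, one_smul]
  have e1 : (∫ a, F₁ a ∂ν) = m1 := rfl
  have e2 : (∫ a, F₂ a ∂ν) = m2 := rfl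
  rw [e1, e2]
  ring

/-- **THE PAIRING BOUND**: `|E[f₁f₂]| ≤ K∕r²⁴` from (447) and the decay of `B(a₁,a₂)`. [folklore] -/
theorem pairing_abs_le (hP : ∀ x F ω, P x F ω = (∫ s, F (update ω x s) * exp (-V (update ω x s))) / ∫ s, exp (-V (update ω x s)))
    (hV : ∀ x ω, HasDerivAt (fun s => V (update ω x s)) (V₁ x ω) (ω x))
    (hfloor : ∀ x ω s t, c x * (s - t) ^ 2 ≤ (V₁ x (update ω x s) - V₁ x (update ω x t)) * (s - t)) (hc : ∀ x, 0 < c x)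
    (hceil : ∀ x ω s t, |V₁ x (update ω x s) - V₁ x (update ω x t)| ≤ Cw * |s - t|)
    (hcross : ∀ x z, z ≠ x → ∀ ω s t, |V₁ x (update ω z s) - V₁ x (update ω z t)| ≤ J x z * |s - t|) (hVc : Continuous V)
    (hV0 : Integrable (fun ω : ι → ℝ => exp (-V ω))) (hV2 : ∀ z, Integrable (fun ω : ι → ℝ => ω z ^ 2 * exp (-V ω)))
    (hJ : ∀ x z, 0 ≤ J x z) (hJ0 : ∀ x, J x x = 0) (hrow : ∀ x, ∑ z, J x z / c x ≤ γ) (hγ0 : 0 ≤ γ) (hγ1 : γ < 1)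
    (hD : ∀ x y, 0 ≤ D x y) (hDC : ∀ x y, (if x = y then (1 : ℝ) else 0) + ∑ z, D x z * (J z y / c z) ≤ D x y)
    (h1 : ∀ z ω s t, |F₁ (update ω z s) - F₁ (update ω z t)| ≤ a₁ z * |s - t|)
    (h2 : ∀ z ω s t, |F₂ (update ω z s) - F₂ (update ω z t)| ≤ a₂ z * |s - t|) {K r : ℝ} (hB : (∑ w, (∑ z, D z w * a₁ z) * (∑ z, D z w * a₂ z) / c w)
        ≤ K / r ^ 24) :
    |∫ ω, (F₁ ω - (∫ ω', F₁ ω' ∂((volume : Measure (ι → ℝ)).tilted fun ω => -V ω))) * (F₂ ω - (∫ ω', F₂ ω' ∂((volume : Measure (ι → ℝ)).tilted fun ω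
        => -V ω))) ∂((volume : Measure (ι → ℝ)).tilted fun ω => -V ω)| ≤ K / r ^ 24 := by
  rw [centred_pair_eq_cov hV0 hV2 h1 h2]
  exact (abs_cov_le_kernel_gibbs hP hV hfloor hc hceil hcross hVc hV0 hV2 hJ hJ0 hrow hγ0 hγ1 hD hDC h1 h2).trans hB

omit [Fintype ι] [DecidableEq ι] in
/-- **Power bookkeeping**: `1 ≤ r_min ≤ r`, `K ≥ 0` give `K∕r²⁴ ≤ K∕r_min⁶`. [folklore] -/
theorem decay_le_min_pow {K r rm : ℝ} (hK : 0 ≤ K) (hrm : 1 ≤ rm) (hr : rm ≤ r) : K / r ^ 24 ≤ K / rm ^ 6 := by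
  have hrm0 : 0 < rm := by linarith
  have h1 : rm ^ 6 ≤ rm ^ 24 := pow_le_pow_right₀ hrm (by norm_num)
  have h2 : rm ^ 24 ≤ r ^ 24 := pow_le_pow_left₀ hrm0.le hr 24
  exact div_le_div_of_nonneg_left hK (by positivity) (h1.trans h2)

omit [Fintype ι] [DecidableEq ι] in
/-- **Power bookkeeping for the Dobrushin term**: `(r_min⁶)²·(nK∕r_min²⁴) ≤ nK∕r_min⁶` (`nK ≥ 0`, `r_min ≥ 1`). [folklore] -/
theorem trunc_sq_decay_le {nK rm : ℝ} (hK : 0 ≤ nK) (hrm : 1 ≤ rm) : (rm ^ 6) ^ 2 * (nK / rm ^ 24) ≤ nK / rm ^ 6 := by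
  have hrm0 : 0 < rm := by linarith
  have e : (rm ^ 6) ^ 2 * (nK / rm ^ 24) = nK / rm ^ 12 := by
    rw [eq_div_iff (by positivity), div_eq_mul_inv]
    have h24 : (rm ^ 24)⁻¹ * rm ^ 24 = 1 := inv_mul_cancel₀ (by positivity)
    calc (rm ^ 6) ^ 2 * (nK * (rm ^ 24)⁻¹) * rm ^ 12 = nK * ((rm ^ 24)⁻¹ * rm ^ 24) := by ring
      _ = nK := by rw [h24, mul_one]
  rw [e]
  exact div_le_div_of_nonneg_left hK (by positivity) (pow_le_pow_right₀ hrm (by norm_num))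

/-! ## §2. The two generic cut bounds -/

/-- **THE PAIR CUT `{1,2}|{3,4}`**: with `R = min(r₁₃,r₁₄,r₂₃,r₂₄)⁶` in (489),
`|E[f₁f₂f₃f₄] − E[f₁f₂]E[f₃f₄]| ≤ (4K + 2M₄ + 2M₆ + 2M₂(M₂+M₄))∕min(r₁₃,r₁₄,r₂₃,r₂₄)⁶`. [folklore] -/
theorem pair_cut_bound (hP : ∀ x F ω, P x F ω = (∫ s, F (update ω x s) * exp (-V (update ω x s))) / ∫ s, exp (-V (update ω x s)))
    (hV : ∀ x ω, HasDerivAt (fun s => V (update ω x s)) (V₁ x ω) (ω x))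
    (hfloor : ∀ x ω s t, c x * (s - t) ^ 2 ≤ (V₁ x (update ω x s) - V₁ x (update ω x t)) * (s - t)) (hc : ∀ x, 0 < c x)
    (hceil : ∀ x ω s t, |V₁ x (update ω x s) - V₁ x (update ω x t)| ≤ Cw * |s - t|)
    (hcross : ∀ x z, z ≠ x → ∀ ω s t, |V₁ x (update ω z s) - V₁ x (update ω z t)| ≤ J x z * |s - t|) (hVc : Continuous V)
    (hV0 : Integrable (fun ω : ι → ℝ => exp (-V ω))) (hV2 : ∀ z, Integrable (fun ω : ι → ℝ => ω z ^ 2 * exp (-V ω)))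
    (hJ : ∀ x z, 0 ≤ J x z) (hJ0 : ∀ x, J x x = 0) (hrow : ∀ x, ∑ z, J x z / c x ≤ γ) (hγ0 : 0 ≤ γ) (hγ1 : γ < 1)
    (hD : ∀ x y, 0 ≤ D x y) (hDC : ∀ x y, (if x = y then (1 : ℝ) else 0) + ∑ z, D x z * (J z y / c z) ≤ D x y)
    (h1 : ∀ z ω s t, |F₁ (update ω z s) - F₁ (update ω z t)| ≤ a₁ z * |s - t|) (h2 : ∀ z ω s t, |F₂ (update ω z s) - F₂ (update ω z t)| ≤ a₂ z * |s -
        t|)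
    (h3 : ∀ z ω s t, |F₃ (update ω z s) - F₃ (update ω z t)| ≤ a₃ z * |s - t|) (h4 : ∀ z ω s t, |F₄ (update ω z s) - F₄ (update ω z t)| ≤ a₄ z * |s -
        t|)
    {K r13 r14 r23 r24 M₂ M₄ M₆ : ℝ} (hK : 0 ≤ K) (hr13 : 1 ≤ r13) (hr14 : 1 ≤ r14) (hr23 : 1 ≤ r23) (hr24 : 1 ≤ r24)
    (hB13 : (∑ w, (∑ z, D z w * a₁ z) * (∑ z, D z w * a₃ z) / c w) ≤ K / r13 ^ 24) (hB14 : (∑ w, (∑ z, D z w * a₁ z) * (∑ z, D z w * a₄ z) / c w) ≤ K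
        / r14 ^ 24)
    (hB23 : (∑ w, (∑ z, D z w * a₂ z) * (∑ z, D z w * a₃ z) / c w) ≤ K / r23 ^ 24) (hB24 : (∑ w, (∑ z, D z w * a₂ z) * (∑ z, D z w * a₄ z) / c w) ≤ K
        / r24 ^ 24)
    (hq1 : Integrable (fun ω => (F₁ ω - (∫ ω', F₁ ω' ∂((volume : Measure (ι → ℝ)).tilted fun ω => -V ω))) ^ 4) ((volume : Measure (ι → ℝ)).tilted fun
        ω => -V ω))
    (hs1 : Integrable (fun ω => (F₁ ω - (∫ ω', F₁ ω' ∂((volume : Measure (ι → ℝ)).tilted fun ω => -V ω))) ^ 6) ((volume : Measure (ι → ℝ)).tilted fun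
        ω => -V ω))
    (hM21 : ∫ ω, (F₁ ω - (∫ ω', F₁ ω' ∂((volume : Measure (ι → ℝ)).tilted fun ω => -V ω))) ^ 2 ∂((volume : Measure (ι → ℝ)).tilted fun ω => -V ω) ≤
        M₂)
    (hM41 : ∫ ω, (F₁ ω - (∫ ω', F₁ ω' ∂((volume : Measure (ι → ℝ)).tilted fun ω => -V ω))) ^ 4 ∂((volume : Measure (ι → ℝ)).tilted fun ω => -V ω) ≤
        M₄)
    (hM61 : ∫ ω, (F₁ ω - (∫ ω', F₁ ω' ∂((volume : Measure (ι → ℝ)).tilted fun ω => -V ω))) ^ 6 ∂((volume : Measure (ι → ℝ)).tilted fun ω => -V ω) ≤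
        M₆)
    (hq2 : Integrable (fun ω => (F₂ ω - (∫ ω', F₂ ω' ∂((volume : Measure (ι → ℝ)).tilted fun ω => -V ω))) ^ 4) ((volume : Measure (ι → ℝ)).tilted fun
        ω => -V ω))
    (hs2 : Integrable (fun ω => (F₂ ω - (∫ ω', F₂ ω' ∂((volume : Measure (ι → ℝ)).tilted fun ω => -V ω))) ^ 6) ((volume : Measure (ι → ℝ)).tilted fun
        ω => -V ω))
    (hM22 : ∫ ω, (F₂ ω - (∫ ω', F₂ ω' ∂((volume : Measure (ι → ℝ)).tilted fun ω => -V ω))) ^ 2 ∂((volume : Measure (ι → ℝ)).tilted fun ω => -V ω) ≤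
        M₂)
    (hM42 : ∫ ω, (F₂ ω - (∫ ω', F₂ ω' ∂((volume : Measure (ι → ℝ)).tilted fun ω => -V ω))) ^ 4 ∂((volume : Measure (ι → ℝ)).tilted fun ω => -V ω) ≤
        M₄)
    (hM62 : ∫ ω, (F₂ ω - (∫ ω', F₂ ω' ∂((volume : Measure (ι → ℝ)).tilted fun ω => -V ω))) ^ 6 ∂((volume : Measure (ι → ℝ)).tilted fun ω => -V ω) ≤
        M₆)
    (hq3 : Integrable (fun ω => (F₃ ω - (∫ ω', F₃ ω' ∂((volume : Measure (ι → ℝ)).tilted fun ω => -V ω))) ^ 4) ((volume : Measure (ι → ℝ)).tilted fun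
        ω => -V ω))
    (hs3 : Integrable (fun ω => (F₃ ω - (∫ ω', F₃ ω' ∂((volume : Measure (ι → ℝ)).tilted fun ω => -V ω))) ^ 6) ((volume : Measure (ι → ℝ)).tilted fun
        ω => -V ω))
    (hM23 : ∫ ω, (F₃ ω - (∫ ω', F₃ ω' ∂((volume : Measure (ι → ℝ)).tilted fun ω => -V ω))) ^ 2 ∂((volume : Measure (ι → ℝ)).tilted fun ω => -V ω) ≤
        M₂)
    (hM43 : ∫ ω, (F₃ ω - (∫ ω', F₃ ω' ∂((volume : Measure (ι → ℝ)).tilted fun ω => -V ω))) ^ 4 ∂((volume : Measure (ι → ℝ)).tilted fun ω => -V ω) ≤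
        M₄)
    (hM63 : ∫ ω, (F₃ ω - (∫ ω', F₃ ω' ∂((volume : Measure (ι → ℝ)).tilted fun ω => -V ω))) ^ 6 ∂((volume : Measure (ι → ℝ)).tilted fun ω => -V ω) ≤
        M₆)
    (hq4 : Integrable (fun ω => (F₄ ω - (∫ ω', F₄ ω' ∂((volume : Measure (ι → ℝ)).tilted fun ω => -V ω))) ^ 4) ((volume : Measure (ι → ℝ)).tilted fun
        ω => -V ω))
    (hs4 : Integrable (fun ω => (F₄ ω - (∫ ω', F₄ ω' ∂((volume : Measure (ι → ℝ)).tilted fun ω => -V ω))) ^ 6) ((volume : Measure (ι → ℝ)).tilted fun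
        ω => -V ω))
    (hM24 : ∫ ω, (F₄ ω - (∫ ω', F₄ ω' ∂((volume : Measure (ι → ℝ)).tilted fun ω => -V ω))) ^ 2 ∂((volume : Measure (ι → ℝ)).tilted fun ω => -V ω) ≤
        M₂)
    (hM44 : ∫ ω, (F₄ ω - (∫ ω', F₄ ω' ∂((volume : Measure (ι → ℝ)).tilted fun ω => -V ω))) ^ 4 ∂((volume : Measure (ι → ℝ)).tilted fun ω => -V ω) ≤
        M₄)
    (hM64 : ∫ ω, (F₄ ω - (∫ ω', F₄ ω' ∂((volume : Measure (ι → ℝ)).tilted fun ω => -V ω))) ^ 6 ∂((volume : Measure (ι → ℝ)).tilted fun ω => -V ω) ≤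
        M₆) :
    |(∫ ω, (F₁ ω - (∫ ω', F₁ ω' ∂((volume : Measure (ι → ℝ)).tilted fun ω => -V ω))) * (F₂ ω - (∫ ω', F₂ ω' ∂((volume : Measure (ι → ℝ)).tilted fun ω
        => -V ω))) * (F₃ ω - (∫ ω', F₃ ω' ∂((volume : Measure (ι → ℝ)).tilted fun ω => -V ω))) * (F₄ ω - (∫ ω', F₄ ω' ∂((volume : Measure (ι →
        ℝ)).tilted fun ω => -V ω))) ∂((volume : Measure (ι → ℝ)).tilted fun ω => -V ω)) -
        (∫ ω, (F₁ ω - (∫ ω', F₁ ω' ∂((volume : Measure (ι → ℝ)).tilted fun ω => -V ω))) * (F₂ ω - (∫ ω', F₂ ω' ∂((volume : Measure (ι → ℝ)).tilted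
            fun ω => -V ω))) ∂((volume : Measure (ι → ℝ)).tilted fun ω => -V ω)) *
          (∫ ω, (F₃ ω - (∫ ω', F₃ ω' ∂((volume : Measure (ι → ℝ)).tilted fun ω => -V ω))) * (F₄ ω - (∫ ω', F₄ ω' ∂((volume : Measure (ι → ℝ)).tilted
              fun ω => -V ω))) ∂((volume : Measure (ι → ℝ)).tilted fun ω => -V ω))| ≤
      (4 * K + (2 * M₄ + 2 * M₆ + 2 * M₂ * (M₂ + M₄))) / (min r13 (min r14 (min r23 r24))) ^ 6 := by
  set rm : ℝ := min r13 (min r14 (min r23 r24)) with hrm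
  have hrm1 : 1 ≤ rm := le_min hr13 (le_min hr14 (le_min hr23 hr24))
  have hrm0 : 0 < rm := by linarith
  have l13 : rm ≤ r13 := min_le_left _ _
  have l14 : rm ≤ r14 := (min_le_right _ _).trans (min_le_left _ _)
  have l23 : rm ≤ r23 := (min_le_right _ _).trans ((min_le_right _ _).trans (min_le_left _ _))
  have l24 : rm ≤ r24 := (min_le_right _ _).trans ((min_le_right _ _).trans (min_le_right _ _))
  have hR : 0 < rm ^ 6 := by positivity
  have h := group_cov_two_two_le hP hV hfloor hc hceil hcross hVc hV0 hV2 hJ hJ0 hrow hγ0 hγ1 hD hDC h1 h2 h3 h4 (∫ ω', F₁ ω' ∂((volume : Measure (ι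
      → ℝ)).tilted fun ω => -V ω)) (∫ ω', F₂ ω' ∂((volume : Measure (ι → ℝ)).tilted fun ω => -V ω))
    (∫ ω', F₃ ω' ∂((volume : Measure (ι → ℝ)).tilted fun ω => -V ω)) (∫ ω', F₄ ω' ∂((volume : Measure (ι → ℝ)).tilted fun ω => -V ω)) hR hq1 hs1 hq2
        hs2 hq3 hs3 hq4 hs4 hM21 hM41 hM61 hM22 hM42 hM62 hM23 hM43 hM63 hM24
    hM44 hM64
  -- the bilinear form across the cut is the sum of the four crossing forms
  have hsplit : ∑ w, ((∑ z, D z w * a₁ z) + ∑ z, D z w * a₂ z) * ((∑ z, D z w * a₃ z) + ∑ z, D z w * a₄ z) / c w =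
      (∑ w, (∑ z, D z w * a₁ z) * (∑ z, D z w * a₃ z) / c w) + (∑ w, (∑ z, D z w * a₁ z) * (∑ z, D z w * a₄ z) / c w) + (∑ w, (∑ z, D z w * a₂ z) *
          (∑ z, D z w * a₃ z) / c w) + (∑ w, (∑ z, D z w * a₂ z) * (∑ z, D z w * a₄ z) / c w) := by
    rw [← Finset.sum_add_distrib, ← Finset.sum_add_distrib, ← Finset.sum_add_distrib]
    exact Finset.sum_congr rfl fun w _ => by ring
  have hB : ∑ w, ((∑ z, D z w * a₁ z) + ∑ z, D z w * a₂ z) * ((∑ z, D z w * a₃ z) + ∑ z, D z w * a₄ z) / c w ≤ 4 * K / rm ^ 24 := by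
    rw [hsplit]
    have e13 := div_le_div_of_nonneg_left hK (by positivity : (0 : ℝ) < rm ^ 24) (pow_le_pow_left₀ hrm0.le l13 24)
    have e14 := div_le_div_of_nonneg_left hK (by positivity : (0 : ℝ) < rm ^ 24) (pow_le_pow_left₀ hrm0.le l14 24)
    have e23 := div_le_div_of_nonneg_left hK (by positivity : (0 : ℝ) < rm ^ 24) (pow_le_pow_left₀ hrm0.le l23 24)
    have e24 := div_le_div_of_nonneg_left hK (by positivity : (0 : ℝ) < rm ^ 24) (pow_le_pow_left₀ hrm0.le l24 24)
    have e4 : 4 * K / rm ^ 24 = K / rm ^ 24 + K / rm ^ 24 + K / rm ^ 24 + K / rm ^ 24 := by ring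
    rw [e4]
    linarith [hB13.trans e13, hB14.trans e14, hB23.trans e23, hB24.trans e24]
  have hT : (rm ^ 6) ^ 2 * (∑ w, ((∑ z, D z w * a₁ z) + ∑ z, D z w * a₂ z) * ((∑ z, D z w * a₃ z) + ∑ z, D z w * a₄ z) / c w) ≤ 4 * K / rm ^ 6 :=
    (mul_le_mul_of_nonneg_left hB (by positivity)).trans (trunc_sq_decay_le (by linarith) hrm1)
  have etot : (4 * K + (2 * M₄ + 2 * M₆ + 2 * M₂ * (M₂ + M₄))) / rm ^ 6 = 4 * K / rm ^ 6 + (2 * M₄ + 2 * M₆ + 2 * M₂ * (M₂ + M₄)) / rm ^ 6 := by ring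
  rw [etot]
  linarith

/-- **THE SINGLE CUT `{1}|{2,3,4}`**: with `R = min(r₁₂,r₁₃,r₁₄)⁶` in (490), `|E[f₁f₂f₃f₄]| ≤ (3K + 4M₄ + 4M₆)∕min(r₁₂,r₁₃,r₁₄)⁶`. [folklore] -/
theorem single_cut_bound (hP : ∀ x F ω, P x F ω = (∫ s, F (update ω x s) * exp (-V (update ω x s))) / ∫ s, exp (-V (update ω x s)))
    (hV : ∀ x ω, HasDerivAt (fun s => V (update ω x s)) (V₁ x ω) (ω x))
    (hfloor : ∀ x ω s t, c x * (s - t) ^ 2 ≤ (V₁ x (update ω x s) - V₁ x (update ω x t)) * (s - t)) (hc : ∀ x, 0 < c x)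
    (hceil : ∀ x ω s t, |V₁ x (update ω x s) - V₁ x (update ω x t)| ≤ Cw * |s - t|)
    (hcross : ∀ x z, z ≠ x → ∀ ω s t, |V₁ x (update ω z s) - V₁ x (update ω z t)| ≤ J x z * |s - t|) (hVc : Continuous V)
    (hV0 : Integrable (fun ω : ι → ℝ => exp (-V ω))) (hV2 : ∀ z, Integrable (fun ω : ι → ℝ => ω z ^ 2 * exp (-V ω)))
    (hJ : ∀ x z, 0 ≤ J x z) (hJ0 : ∀ x, J x x = 0) (hrow : ∀ x, ∑ z, J x z / c x ≤ γ) (hγ0 : 0 ≤ γ) (hγ1 : γ < 1)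
    (hD : ∀ x y, 0 ≤ D x y) (hDC : ∀ x y, (if x = y then (1 : ℝ) else 0) + ∑ z, D x z * (J z y / c z) ≤ D x y)
    (h1 : ∀ z ω s t, |F₁ (update ω z s) - F₁ (update ω z t)| ≤ a₁ z * |s - t|) (h2 : ∀ z ω s t, |F₂ (update ω z s) - F₂ (update ω z t)| ≤ a₂ z * |s -
        t|)
    (h3 : ∀ z ω s t, |F₃ (update ω z s) - F₃ (update ω z t)| ≤ a₃ z * |s - t|) (h4 : ∀ z ω s t, |F₄ (update ω z s) - F₄ (update ω z t)| ≤ a₄ z * |s -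
        t|)
    {K r12 r13 r14 M₄ M₆ : ℝ} (hK : 0 ≤ K) (hr12 : 1 ≤ r12) (hr13 : 1 ≤ r13) (hr14 : 1 ≤ r14)
    (hB12 : (∑ w, (∑ z, D z w * a₁ z) * (∑ z, D z w * a₂ z) / c w) ≤ K / r12 ^ 24) (hB13 : (∑ w, (∑ z, D z w * a₁ z) * (∑ z, D z w * a₃ z) / c w) ≤ K
        / r13 ^ 24)
    (hB14 : (∑ w, (∑ z, D z w * a₁ z) * (∑ z, D z w * a₄ z) / c w) ≤ K / r14 ^ 24)
    (hq1 : Integrable (fun ω => (F₁ ω - (∫ ω', F₁ ω' ∂((volume : Measure (ι → ℝ)).tilted fun ω => -V ω))) ^ 4) ((volume : Measure (ι → ℝ)).tilted fun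
        ω => -V ω))
    (hs1 : Integrable (fun ω => (F₁ ω - (∫ ω', F₁ ω' ∂((volume : Measure (ι → ℝ)).tilted fun ω => -V ω))) ^ 6) ((volume : Measure (ι → ℝ)).tilted fun
        ω => -V ω))
    (hq2 : Integrable (fun ω => (F₂ ω - (∫ ω', F₂ ω' ∂((volume : Measure (ι → ℝ)).tilted fun ω => -V ω))) ^ 4) ((volume : Measure (ι → ℝ)).tilted fun
        ω => -V ω))
    (hs2 : Integrable (fun ω => (F₂ ω - (∫ ω', F₂ ω' ∂((volume : Measure (ι → ℝ)).tilted fun ω => -V ω))) ^ 6) ((volume : Measure (ι → ℝ)).tilted fun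
        ω => -V ω))
    (hq3 : Integrable (fun ω => (F₃ ω - (∫ ω', F₃ ω' ∂((volume : Measure (ι → ℝ)).tilted fun ω => -V ω))) ^ 4) ((volume : Measure (ι → ℝ)).tilted fun
        ω => -V ω))
    (hs3 : Integrable (fun ω => (F₃ ω - (∫ ω', F₃ ω' ∂((volume : Measure (ι → ℝ)).tilted fun ω => -V ω))) ^ 6) ((volume : Measure (ι → ℝ)).tilted fun
        ω => -V ω))
    (hq4 : Integrable (fun ω => (F₄ ω - (∫ ω', F₄ ω' ∂((volume : Measure (ι → ℝ)).tilted fun ω => -V ω))) ^ 4) ((volume : Measure (ι → ℝ)).tilted fun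
        ω => -V ω))
    (hs4 : Integrable (fun ω => (F₄ ω - (∫ ω', F₄ ω' ∂((volume : Measure (ι → ℝ)).tilted fun ω => -V ω))) ^ 6) ((volume : Measure (ι → ℝ)).tilted fun
        ω => -V ω))
    (hM41 : ∫ ω, (F₁ ω - (∫ ω', F₁ ω' ∂((volume : Measure (ι → ℝ)).tilted fun ω => -V ω))) ^ 4 ∂((volume : Measure (ι → ℝ)).tilted fun ω => -V ω) ≤
        M₄) (hM61 : ∫ ω, (F₁ ω - (∫ ω', F₁ ω' ∂((volume : Measure (ι → ℝ)).tilted fun ω => -V ω))) ^ 6 ∂((volume : Measure (ι → ℝ)).tilted fun ω =>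
        -V ω) ≤ M₆)
    (hM42 : ∫ ω, (F₂ ω - (∫ ω', F₂ ω' ∂((volume : Measure (ι → ℝ)).tilted fun ω => -V ω))) ^ 4 ∂((volume : Measure (ι → ℝ)).tilted fun ω => -V ω) ≤
        M₄) (hM62 : ∫ ω, (F₂ ω - (∫ ω', F₂ ω' ∂((volume : Measure (ι → ℝ)).tilted fun ω => -V ω))) ^ 6 ∂((volume : Measure (ι → ℝ)).tilted fun ω =>
        -V ω) ≤ M₆)
    (hM43 : ∫ ω, (F₃ ω - (∫ ω', F₃ ω' ∂((volume : Measure (ι → ℝ)).tilted fun ω => -V ω))) ^ 4 ∂((volume : Measure (ι → ℝ)).tilted fun ω => -V ω) ≤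
        M₄) (hM63 : ∫ ω, (F₃ ω - (∫ ω', F₃ ω' ∂((volume : Measure (ι → ℝ)).tilted fun ω => -V ω))) ^ 6 ∂((volume : Measure (ι → ℝ)).tilted fun ω =>
        -V ω) ≤ M₆)
    (hM44 : ∫ ω, (F₄ ω - (∫ ω', F₄ ω' ∂((volume : Measure (ι → ℝ)).tilted fun ω => -V ω))) ^ 4 ∂((volume : Measure (ι → ℝ)).tilted fun ω => -V ω) ≤
        M₄) (hM64 : ∫ ω, (F₄ ω - (∫ ω', F₄ ω' ∂((volume : Measure (ι → ℝ)).tilted fun ω => -V ω))) ^ 6 ∂((volume : Measure (ι → ℝ)).tilted fun ω =>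
        -V ω) ≤ M₆) :
    |∫ ω, (F₁ ω - (∫ ω', F₁ ω' ∂((volume : Measure (ι → ℝ)).tilted fun ω => -V ω))) * (F₂ ω - (∫ ω', F₂ ω' ∂((volume : Measure (ι → ℝ)).tilted fun ω
        => -V ω))) * (F₃ ω - (∫ ω', F₃ ω' ∂((volume : Measure (ι → ℝ)).tilted fun ω => -V ω))) * (F₄ ω - (∫ ω', F₄ ω' ∂((volume : Measure (ι →
        ℝ)).tilted fun ω => -V ω))) ∂((volume : Measure (ι → ℝ)).tilted fun ω => -V ω)| ≤
      (3 * K + (4 * M₄ + 4 * M₆)) / (min r12 (min r13 r14)) ^ 6 := by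
  set rm : ℝ := min r12 (min r13 r14) with hrm
  have hrm1 : 1 ≤ rm := le_min hr12 (le_min hr13 hr14)
  have hrm0 : 0 < rm := by linarith
  have l12 : rm ≤ r12 := min_le_left _ _
  have l13 : rm ≤ r13 := (min_le_right _ _).trans (min_le_left _ _)
  have l14 : rm ≤ r14 := (min_le_right _ _).trans (min_le_right _ _)
  have hR : 0 < rm ^ 6 := by positivity
  have h := group_cov_one_three_le hP hV hfloor hc hceil hcross hVc hV0 hV2 hJ hJ0 hrow hγ0 hγ1 hD hDC h1 h2 h3 h4 (∫ ω', F₂ ω' ∂((volume : Measure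
      (ι → ℝ)).tilted fun ω => -V ω)) (∫ ω', F₃ ω' ∂((volume : Measure (ι → ℝ)).tilted fun ω => -V ω)) (∫ ω', F₄ ω' ∂((volume : Measure (ι →
      ℝ)).tilted fun ω => -V ω))
    hR hq1 hs1 hq2 hs2 hq3 hs3 hq4 hs4 hM41 hM61 hM42 hM62 hM43 hM63 hM44 hM64
  have hsplit : ∑ w, (∑ z, D z w * a₁ z) * ((∑ z, D z w * a₂ z) + (∑ z, D z w * a₃ z) + ∑ z, D z w * a₄ z) / c w =
      (∑ w, (∑ z, D z w * a₁ z) * (∑ z, D z w * a₂ z) / c w) + (∑ w, (∑ z, D z w * a₁ z) * (∑ z, D z w * a₃ z) / c w) + (∑ w, (∑ z, D z w * a₁ z) *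
          (∑ z, D z w * a₄ z) / c w) := by
    rw [← Finset.sum_add_distrib, ← Finset.sum_add_distrib]
    exact Finset.sum_congr rfl fun w _ => by ring
  have hB : ∑ w, (∑ z, D z w * a₁ z) * ((∑ z, D z w * a₂ z) + (∑ z, D z w * a₃ z) + ∑ z, D z w * a₄ z) / c w ≤ 3 * K / rm ^ 24 := by
    rw [hsplit]
    have e12 := div_le_div_of_nonneg_left hK (by positivity : (0 : ℝ) < rm ^ 24) (pow_le_pow_left₀ hrm0.le l12 24)
    have e13 := div_le_div_of_nonneg_left hK (by positivity : (0 : ℝ) < rm ^ 24) (pow_le_pow_left₀ hrm0.le l13 24)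
    have e14 := div_le_div_of_nonneg_left hK (by positivity : (0 : ℝ) < rm ^ 24) (pow_le_pow_left₀ hrm0.le l14 24)
    have e3 : 3 * K / rm ^ 24 = K / rm ^ 24 + K / rm ^ 24 + K / rm ^ 24 := by ring
    rw [e3]
    linarith [hB12.trans e12, hB13.trans e13, hB14.trans e14]
  have hT : (rm ^ 6) ^ 2 * (∑ w, (∑ z, D z w * a₁ z) * ((∑ z, D z w * a₂ z) + (∑ z, D z w * a₃ z) + ∑ z, D z w * a₄ z) / c w) ≤ 3 * K / rm ^ 6 :=
    (mul_le_mul_of_nonneg_left hB (by positivity)).trans (trunc_sq_decay_le (by linarith) hrm1)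
  have etot : (3 * K + (4 * M₄ + 4 * M₆)) / rm ^ 6 = 3 * K / rm ^ 6 + (4 * M₄ + 4 * M₆) / rm ^ 6 := by ring
  rw [etot]
  linarith

/-! ## §3. Toy -/

/-- Toy (§1's bookkeeping in numbers): `(2⁶)²·(1∕2²⁴) ≤ 1∕2⁶`. -/
example : ((2 : ℝ) ^ 6) ^ 2 * (1 / (2 : ℝ) ^ 24) ≤ 1 / (2 : ℝ) ^ 6 := trunc_sq_decay_le zero_le_one (by norm_num)

end Summit.QuantumFields.BalabanUV.T4Continuum.NE7b.SupFourthCumulantCutBounds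

end
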